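import Mathlib

/-!
# The abstract counting layer of the REDUCTION THEOREM (p6, gen 26; C-041.md §11 (e))

Pure counting, no graphs (the LEAN SHEET of C-041.md §11 (e)).  A finite index type `ι` (the zones
meeting `K₀`); for each `i` a finite state type `S i` with subsets `L i`, `U i`, `R i` (`L i` and `R i`
disjoint from `U i`); a finite type `T` (the states of the zones missing `K₀`, weight `N_out = #T`); the
global state space `(∀ i, S i) × T` with predicates `inv` (invalid), `rho` (`ρ_t(u″)`) and `good` (`G_t`).

* (H1) `inv σ → ¬ rho σ → (∀ i, σ.1 i ∈ L i ∪ U i) ∧ ∃ i, σ.1 i ∈ L i`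
  (every zone blue at `K`, and some anchor deleted);
* (H2) `(∀ i, σ.1 i ∈ R i ∪ U i) → (∃ i, σ.1 i ∈ R i) → ¬ inv σ ∧ ¬ good σ ∧ rho σ`
  (admissible, valid through the `R`-zone, no anchor deleted, no red `2`-edge on the reach).

Conclusions — the two product bounds of the REDUCTION THEOREM —
`#{σ | inv σ ∧ ¬ rho σ} ≤ (∏ i, (#L i + #U i) − ∏ i, #U i) · #T` (`card_inv_not_rho_le`) and
`(∏ i, (#R i + #U i) − ∏ i, #U i) · #T ≤ #{σ | ¬ inv σ ∧ ¬ good σ ∧ rho σ}` (`le_card_not_inv_not_good_rho`),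
the ZONE-LEMMA FORM `(∀ i, #L i ≤ #R i) → #{inv ∧ ¬ rho} ≤ #{¬ inv ∧ ¬ good ∧ rho}` (`card_le_of_zone_card_le`),
and the explicit (INV)-injection from per-zone injections `L i ↪ R i` applied in the touched zones only
(`zoneMap`, `zoneMap_injOn`, `card_le_of_zone_injOn`).
-/

namespace PercRepro

namespace ZoneReduction

open Finset

variable {ι : Type*} {S : ι → Type*} [∀ i, DecidableEq (S i)] {T : Type*}

/-! ## The zone map: per-zone maps applied in the touched zones only -/

/-- The global map built from per-zone maps `f i`: apply `f i` in the zones whose state lies in `L i`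
(the touched zones), leave the other zones and the `T`-coordinate alone. -/
def zoneMap (L : ∀ i, Finset (S i)) (f : ∀ i, S i → S i) (σ : (∀ i, S i) × T) : (∀ i, S i) × T :=
  (fun i => if σ.1 i ∈ L i then f i (σ.1 i) else σ.1 i, σ.2)

/-- A coordinate of the image: touched zones go through `f i`. -/
theorem zoneMap_fst_of_mem (L : ∀ i, Finset (S i)) (f : ∀ i, S i → S i) (σ : (∀ i, S i) × T) {i : ι}
    (h : σ.1 i ∈ L i) : (zoneMap L f σ).1 i = f i (σ.1 i) := by
  simp only [zoneMap, if_pos h]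

/-- A coordinate of the image: untouched zones are left alone. -/
theorem zoneMap_fst_of_not_mem (L : ∀ i, Finset (S i)) (f : ∀ i, S i → S i) (σ : (∀ i, S i) × T)
    {i : ι} (h : σ.1 i ∉ L i) : (zoneMap L f σ).1 i = σ.1 i := by
  simp only [zoneMap, if_neg h]

/-- The image of a state with every zone in `L i ∪ U i` has every zone in `R i ∪ U i`, and the touched
zones are exactly the zones of the image lying in `R i` (they are recognisable in the image). -/
theorem zoneMap_mem (L U R : ∀ i, Finset (S i)) (hRU : ∀ i, Disjoint (R i) (U i))
    (f : ∀ i, S i → S i) (hf : ∀ i, ∀ x ∈ L i, f i x ∈ R i) (σ : (∀ i, S i) × T)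
    (hσ : ∀ i, σ.1 i ∈ L i ∪ U i) (i : ι) :
    (zoneMap L f σ).1 i ∈ R i ∪ U i ∧ ((zoneMap L f σ).1 i ∈ R i ↔ σ.1 i ∈ L i) := by
  by_cases h : σ.1 i ∈ L i
  · rw [zoneMap_fst_of_mem L f σ h]
    exact ⟨Finset.mem_union_left _ (hf i _ h), iff_of_true (hf i _ h) h⟩
  · rw [zoneMap_fst_of_not_mem L f σ h]
    have hU : σ.1 i ∈ U i := (Finset.mem_union.mp (hσ i)).resolve_left h
    exact ⟨Finset.mem_union_right _ hU, iff_of_false (Finset.disjoint_right.mp (hRU i) hU) h⟩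

/-- `zoneMap` is injective on the states with every zone in `L i ∪ U i`, when each `f i` is injective
on `L i` and maps `L i` into `R i` (disjoint from `U i`). -/
theorem zoneMap_injOn (L U R : ∀ i, Finset (S i)) (hRU : ∀ i, Disjoint (R i) (U i))
    (f : ∀ i, S i → S i) (hf : ∀ i, ∀ x ∈ L i, f i x ∈ R i)
    (hinj : ∀ i, Set.InjOn (f i) (L i)) :
    Set.InjOn (zoneMap (T := T) L f) {σ | ∀ i, σ.1 i ∈ L i ∪ U i} := by
  intro σ hσ σ' hσ' heq
  have hsnd : (zoneMap L f σ).2 = (zoneMap L f σ').2 := congrArg Prod.snd heq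
  refine Prod.ext (funext fun i => ?_) hsnd
  have hi : (zoneMap L f σ).1 i = (zoneMap L f σ').1 i := congrFun (congrArg Prod.fst heq) i
  have hm := zoneMap_mem L U R hRU f hf σ hσ i
  have hm' := zoneMap_mem L U R hRU f hf σ' hσ' i
  by_cases h : σ.1 i ∈ L i
  · have h' : σ'.1 i ∈ L i := hm'.2.mp (hi ▸ hm.2.mpr h)
    rw [zoneMap_fst_of_mem L f σ h, zoneMap_fst_of_mem L f σ' h'] at hi
    exact hinj i h h' hi
  · have h' : σ'.1 i ∉ L i := fun h' => h (hm.2.mp (hi ▸ hm'.2.mpr h'))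
    rwa [zoneMap_fst_of_not_mem L f σ h, zoneMap_fst_of_not_mem L f σ' h'] at hi

variable [Fintype ι] [DecidableEq ι]

/-! ## The product sets -/

/-- The product set of zone states with every coordinate in `A i ∪ U i` and some coordinate outside
`U`: `{σ | ∀ i, σ i ∈ A i ∪ U i} \ {σ | ∀ i, σ i ∈ U i}`. -/
def mixed (A U : ∀ i, Finset (S i)) : Finset (∀ i, S i) :=
  Fintype.piFinset (fun i => A i ∪ U i) \ Fintype.piFinset U

/-- Membership in `mixed`. -/
theorem mem_mixed {A U : ∀ i, Finset (S i)} {σ : ∀ i, S i} :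
    σ ∈ mixed A U ↔ (∀ i, σ i ∈ A i ∪ U i) ∧ ¬ ∀ i, σ i ∈ U i := by
  simp only [mixed, Finset.mem_sdiff, Fintype.mem_piFinset]

/-- The product formula: `#(mixed A U) = ∏ i, (#A i + #U i) − ∏ i, #U i` when `A i`, `U i` are disjoint. -/
theorem card_mixed (A U : ∀ i, Finset (S i)) (h : ∀ i, Disjoint (A i) (U i)) :
    (mixed A U).card = ∏ i, ((A i).card + (U i).card) - ∏ i, (U i).card := by
  unfold mixed
  rw [card_sdiff_of_subset (Fintype.piFinset_subset _ _ fun i => subset_union_right),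
    Fintype.card_piFinset, Fintype.card_piFinset]
  congr 1
  exact Finset.prod_congr rfl fun i _ => card_union_of_disjoint (h i)

/-! ## The two product bounds -/

variable [∀ i, Fintype (S i)] [Fintype T]
variable (inv rho good : (∀ i, S i) × T → Prop)
  [DecidablePred inv] [DecidablePred rho] [DecidablePred good]

/-- **LEFT BOUND** (C-041.md §11, REDUCTION THEOREM): under (H1),
`#{σ | inv σ ∧ ¬ rho σ} ≤ (∏ i, (#L i + #U i) − ∏ i, #U i) · #T`. -/
theorem card_inv_not_rho_le (L U : ∀ i, Finset (S i)) (hLU : ∀ i, Disjoint (L i) (U i))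
    (H1 : ∀ σ, inv σ → ¬ rho σ → (∀ i, σ.1 i ∈ L i ∪ U i) ∧ ∃ i, σ.1 i ∈ L i) :
    (univ.filter fun σ => inv σ ∧ ¬ rho σ).card
      ≤ (∏ i, ((L i).card + (U i).card) - ∏ i, (U i).card) * Fintype.card T := by
  rw [← card_mixed L U hLU, ← Finset.card_univ, ← Finset.card_product]
  apply Finset.card_le_card
  intro σ hσ
  rw [Finset.mem_filter] at hσ
  obtain ⟨h1, i, hi⟩ := H1 σ hσ.2.1 hσ.2.2
  rw [Finset.mem_product, mem_mixed]
  refine ⟨⟨h1, fun hU => ?_⟩, Finset.mem_univ _⟩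
  exact Finset.disjoint_left.mp (hLU i) hi (hU i)

/-- **RIGHT BOUND** (C-041.md §11, REDUCTION THEOREM): under (H2),
`(∏ i, (#R i + #U i) − ∏ i, #U i) · #T ≤ #{σ | ¬ inv σ ∧ ¬ good σ ∧ rho σ}`. -/
theorem le_card_not_inv_not_good_rho (R U : ∀ i, Finset (S i)) (hRU : ∀ i, Disjoint (R i) (U i))
    (H2 : ∀ σ, (∀ i, σ.1 i ∈ R i ∪ U i) → (∃ i, σ.1 i ∈ R i) → ¬ inv σ ∧ ¬ good σ ∧ rho σ) :
    (∏ i, ((R i).card + (U i).card) - ∏ i, (U i).card) * Fintype.card T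
      ≤ (univ.filter fun σ => ¬ inv σ ∧ ¬ good σ ∧ rho σ).card := by
  rw [← card_mixed R U hRU, ← Finset.card_univ, ← Finset.card_product]
  apply Finset.card_le_card
  intro σ hσ
  rw [Finset.mem_product, mem_mixed] at hσ
  obtain ⟨⟨h1, h2⟩, -⟩ := hσ
  rw [Finset.mem_filter]
  refine ⟨Finset.mem_univ _, H2 σ h1 ?_⟩
  by_contra hne
  apply h2
  intro i
  rcases Finset.mem_union.mp (h1 i) with hR | hU
  · exact absurd ⟨i, hR⟩ hne
  · exact hU

/-- **ZONE-LEMMA FORM** (C-041.md §11 (e)): `∀ i, #L i ≤ #R i` and (H1), (H2) give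
`#{inv ∧ ¬ rho} ≤ #{¬ inv ∧ ¬ good ∧ rho}` — the middle expression is monotone in each `#L i`. -/
theorem card_le_of_zone_card_le (L U R : ∀ i, Finset (S i))
    (hLU : ∀ i, Disjoint (L i) (U i)) (hRU : ∀ i, Disjoint (R i) (U i))
    (H1 : ∀ σ, inv σ → ¬ rho σ → (∀ i, σ.1 i ∈ L i ∪ U i) ∧ ∃ i, σ.1 i ∈ L i)
    (H2 : ∀ σ, (∀ i, σ.1 i ∈ R i ∪ U i) → (∃ i, σ.1 i ∈ R i) → ¬ inv σ ∧ ¬ good σ ∧ rho σ)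
    (hLR : ∀ i, (L i).card ≤ (R i).card) :
    (univ.filter fun σ => inv σ ∧ ¬ rho σ).card
      ≤ (univ.filter fun σ => ¬ inv σ ∧ ¬ good σ ∧ rho σ).card := by
  refine (card_inv_not_rho_le inv rho L U hLU H1).trans ?_
  refine le_trans ?_ (le_card_not_inv_not_good_rho inv rho good R U hRU H2)
  apply Nat.mul_le_mul_right
  apply Nat.sub_le_sub_right
  exact Finset.prod_le_prod (fun i _ => Nat.zero_le _) fun i _ => Nat.add_le_add_right (hLR i) _

/-! ## The explicit injection from per-zone injections `L i ↪ R i` (touched zones only) -/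

/-- **THE EXPLICIT (INV)-INJECTION** (C-041.md §11): per-zone injections `L i ↪ R i`, applied in the
touched zones only, inject `{inv ∧ ¬ rho}` into `{¬ inv ∧ ¬ good ∧ rho}`; hence the count inequality. -/
theorem card_le_of_zone_injOn (L U R : ∀ i, Finset (S i)) (hRU : ∀ i, Disjoint (R i) (U i))
    (H1 : ∀ σ, inv σ → ¬ rho σ → (∀ i, σ.1 i ∈ L i ∪ U i) ∧ ∃ i, σ.1 i ∈ L i)
    (H2 : ∀ σ, (∀ i, σ.1 i ∈ R i ∪ U i) → (∃ i, σ.1 i ∈ R i) → ¬ inv σ ∧ ¬ good σ ∧ rho σ)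
    (f : ∀ i, S i → S i) (hf : ∀ i, ∀ x ∈ L i, f i x ∈ R i)
    (hinj : ∀ i, Set.InjOn (f i) (L i)) :
    (univ.filter fun σ => inv σ ∧ ¬ rho σ).card
      ≤ (univ.filter fun σ => ¬ inv σ ∧ ¬ good σ ∧ rho σ).card := by
  apply Finset.card_le_card_of_injOn (zoneMap L f)
  · intro σ hσ
    rw [Finset.mem_coe, Finset.mem_filter] at hσ
    obtain ⟨h1, i, hi⟩ := H1 σ hσ.2.1 hσ.2.2
    rw [Finset.mem_coe, Finset.mem_filter]
    refine ⟨Finset.mem_univ _, H2 _ (fun j => (zoneMap_mem L U R hRU f hf σ h1 j).1) ⟨i, ?_⟩⟩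
    exact (zoneMap_mem L U R hRU f hf σ h1 i).2.mpr hi
  · intro σ hσ σ' hσ' heq
    rw [Finset.mem_coe, Finset.mem_filter] at hσ hσ'
    exact zoneMap_injOn L U R hRU f hf hinj (H1 σ hσ.2.1 hσ.2.2).1 (H1 σ' hσ'.2.1 hσ'.2.2).1 heq

end ZoneReduction

end PercRepro
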